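import Summits.BirchSwinnertonDyer.BirchSwinnertonDyer.Theorems.SignedLowerHalvesKobayashiLowerHalfLargeImageParityStratumFE
import Literature.NumberTheory.EllipticCurves.Kobayashi2003.SignedKatoDivisibility
import HarnessLib

/-!
# Route `SignedLowerHalves` (K3), crux 4 `KobayashiMainConjectureSmallImage` (item stmt-BirchSwinnertonDyer-19002):
# AT SMALL IMAGE THE INTEGRALITY DEFECT OF KATO'S DIVISIBILITY IS EXACTLY `μ` — Kobayashi's Thm. 4.1 becomes
# `ξ^ε ∣ L_p^ε` at ANY image as soon as `μ(ξ^ε) = 0`, and then the main conjecture follows from the Eisenstein half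

Cell `bsd-ssimc`, seat `bsd-line-slh-p3` LEAD gen 12 (helper file `--supports stmt-BirchSwinnertonDyer-19002`; SUPPORT ONLY,
route-independent — no `Theses` import). HONEST FRAMING: THEOREMS ONLY, CONDITIONAL on displayed published binders
(Kobayashi 2003 Thm. 1.2 `h12`, Thm. 4.1 `h41` — ONLY its first, image-free display `∃ n, pⁿ L_p^ε ∈ Char X^ε` —, the
period units `h5 h3`) and on displayed per-pair hypotheses (`μ(ξ^ε) = 0`, the Eisenstein half); nothing about any curve
is asserted; BSD / crux 4 NOT proved.

## Why

Kobayashi's Thm. 4.1 (Kato's Euler system) gives `pⁿ L_p^ε ∈ Char X^ε` for every `E` and `L_p^ε ∈ Char X^ε` when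
`ρ_{E,p^∞}` is onto (`thm41_signedCharIdeal_divisibility`, both displays typed). On crux 4's domain (image `C_ns⁺(p)`)
only the first is available, and every small-image line of the route (birth, birth_acns v2–v13) had to route the missing
`p`-power through a `μ`-argument (saturation, Conjecture A, the one-sign rider). This file isolates the algebra behind
that: in `Λ = ℤ_p⟦T⟧` the constant `p` is PRIME (`Λ/p = 𝔽_p⟦T⟧` is a domain), so **`ξ ∣ pⁿ L` and `p ∤ ξ` (i.e.
`μ(ξ) = 0`) imply `ξ ∣ L`**. Hence at ANY image: `μ(ξ^ε) = 0 ⟹ ξ^ε ∣ L_p^ε` (Thm. 4.1 made integral by `μ`), and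
`KobayashiLowerDivisibility W p ε ∧ μ^ε = 0 ⟹ KobayashiMainConjecture W p ε` — the `mu`-currency twin of width lane
B's `SmallImageSignedMuDefect.kobayashiMainConjecture_of_lengthAt_le_of_lowerDivisibility` (length-at-`(p)` currency),
with no ζ-package and no Conjecture A.

## What is proved

* §1 (algebra in `Λ`) `C_natCast_dvd_or_dvd_of_dvd_mul` (`p ∣ ab ⟹ p ∣ a ∨ p ∣ b`), `dvd_of_mul_eq_C_pow_mul_of_mu_eq_zero`,
  `dvd_of_dvd_C_pow_mul_of_mu_eq_zero` (`ξ ∣ pⁿ L`, `ξ ≠ 0`, `μ(ξ) = 0` ⟹ `ξ ∣ L`).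
* §2 `dvd_of_charIdeal_eq_span_of_mu_eq_zero` — **Kobayashi Thm. 4.1 INTEGRAL at ANY image given `μ(ξ^ε) = 0`**
  (granted `h41`; `L` any `IsSignedPAdicLFunction`, `L ≠ 0`).
* §3 `kobayashiMainConjecture_of_lowerDivisibility_of_mu_eq_zero` — ANY image, ANY rank: the Eisenstein half for `ε` +
  «`μ(ξ^ε) = 0` for a characteristic power series of every key-`γ` datum» ⟹ `KobayashiMainConjecture W p ε`, granted
  `h12 h41 h5 h3` only.

References: [Kobayashi2003] Thm. 1.2, Thm. 4.1 (p. 8), Conjecture (p. 2); [Kato2004Asterisque] Thm. 12.5, §17.13;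
[Washington1997] §7.1, §13.1 (`Λ/pΛ ≅ 𝔽_p⟦T⟧`); [GreenbergVatsal2000] p. 4. Tree: `Rank1Residual/X1/MuLambdaAlgebra`,
`…SmallImageSignedMuDefect` (k3-c4x), `…SmallImageParityStratumExact` (this seat).
-/

set_option autoImplicit false
set_option linter.dupNamespace false

noncomputable section

open scoped Classical MatrixGroups ModularForm

open CongruenceSubgroup PowerSeries WeierstrassCurve Field Literature.NumberTheory.EllipticCurves
  Literature.NumberTheory.EllipticCurves.ModularForms
  Literature.NumberTheory.EllipticCurves.Rank1Residual Literature.NumberTheory.EllipticCurves.Sprung2017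
  Literature.NumberTheory.EllipticCurves.Kobayashi2003 ZpExtension
  Literature.NumberTheory.EllipticCurves.Rank1Residual.Typed
  Summit.BirchSwinnertonDyer.Rank1Residual.X1.MuLambda
  Summit.BirchSwinnertonDyer.Rank1Residual.Supersingular

namespace Summit.BirchSwinnertonDyer.BirchSwinnertonDyer.Theorems.SmallImageKatoIntegralOfMu

/-! ## §1. `p` is prime in `Λ`: `ξ ∣ pⁿ L`, `μ(ξ) = 0` ⟹ `ξ ∣ L` -/

section Algebra

variable {p : ℕ} [Fact p.Prime]

/-- **`p` is a prime element of `Λ = ℤ_p⟦T⟧`**: `p ∣ a·b ⟹ p ∣ a ∨ p ∣ b` (reduce mod `p`: `𝔽_p⟦T⟧` is a domain;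
`red_eq_zero_iff`). [cite: Washington1997, §13.1 (`Λ/pΛ ≅ 𝔽_p⟦T⟧`)] -/
theorem C_natCast_dvd_or_dvd_of_dvd_mul {a b : IwasawaAlgebra p} (h : C (p : ℤ_[p]) ∣ a * b) :
    C (p : ℤ_[p]) ∣ a ∨ C (p : ℤ_[p]) ∣ b := by
  rw [← red_eq_zero_iff, ← red_eq_zero_iff]
  rw [← red_eq_zero_iff] at h
  have hab : red a * red b = 0 := by rwa [red, map_mul] at h
  exact mul_eq_zero.mp hab

/-- Induction carrier: `ξ · w = pⁿ · L` with `p ∤ ξ` (`red ξ ≠ 0`) forces `ξ ∣ L` (peel one `p` off `w` at a time and cancel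
it in the domain `Λ`). [cite: Washington1997, §7.1 and §13.1] -/
theorem dvd_of_mul_eq_C_pow_mul_of_red_ne_zero {ξ : IwasawaAlgebra p} (hred : red ξ ≠ 0) :
    ∀ (n : ℕ) (w L : IwasawaAlgebra p), ξ * w = C ((p : ℤ_[p]) ^ n) * L → ξ ∣ L := by
  intro n
  induction n with
  | zero =>
    intro w L h
    rw [pow_zero, map_one, one_mul] at h
    exact ⟨w, h.symm⟩
  | succ n ih =>
    intro w L h
    -- `p ∣ ξ w`, `p ∤ ξ` ⟹ `p ∣ w`
    have hp : C (p : ℤ_[p]) ∣ ξ * w := by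
      refine ⟨C ((p : ℤ_[p]) ^ n) * L, ?_⟩
      rw [h, pow_succ, map_mul]; ring
    have hξ : ¬ C (p : ℤ_[p]) ∣ ξ := by rwa [← red_eq_zero_iff]
    obtain ⟨w', hw'⟩ := (C_natCast_dvd_or_dvd_of_dvd_mul hp).resolve_left hξ
    -- cancel `p`
    have hC0 : (C (p : ℤ_[p]) : IwasawaAlgebra p) ≠ 0 := by
      have := C_pow_ne_zero (p := p) 1
      rwa [pow_one] at this
    have h' : C (p : ℤ_[p]) * (ξ * w') = C (p : ℤ_[p]) * (C ((p : ℤ_[p]) ^ n) * L) := by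
      calc C (p : ℤ_[p]) * (ξ * w') = ξ * w := by rw [hw']; ring
        _ = C ((p : ℤ_[p]) ^ (n + 1)) * L := h
        _ = C (p : ℤ_[p]) * (C ((p : ℤ_[p]) ^ n) * L) := by rw [pow_succ, map_mul]; ring
    exact ih w' L (mul_left_cancel₀ hC0 h')

/-- **`ξ ∣ pⁿ · L`, `ξ ≠ 0`, `μ(ξ) = 0` ⟹ `ξ ∣ L`** in `Λ` (`μ(ξ) = 0` means `p ∤ ξ`: `ξ = pfree ξ`, `red (pfree ξ) ≠ 0`).
[cite: Washington1997, §7.1 and §13.1] [cite: GreenbergVatsal2000, p. 4] -/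
theorem dvd_of_dvd_C_pow_mul_of_mu_eq_zero {ξ L : IwasawaAlgebra p} {n : ℕ}
    (hdvd : ξ ∣ C ((p : ℤ_[p]) ^ n) * L) (hξ0 : ξ ≠ 0) (hμ : mu ξ = 0) : ξ ∣ L := by
  have hpf : pfree ξ = ξ := by
    have := eq_C_pow_mu_mul_pfree ξ
    rw [hμ, pow_zero, map_one, one_mul] at this
    exact this.symm
  have hred : red ξ ≠ 0 := by rw [← hpf]; exact red_pfree_ne_zero hξ0
  obtain ⟨w, hw⟩ := hdvd
  exact dvd_of_mul_eq_C_pow_mul_of_red_ne_zero hred n w L hw.symm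

/-- The same with the power of `p` written as `(p : Λ)ⁿ` (the spelling of `thm41_signedCharIdeal_divisibility.exists_dvd_pow_mul`).
[cite: Washington1997, §7.1 and §13.1] -/
theorem dvd_of_dvd_natCast_pow_mul_of_mu_eq_zero {ξ L : IwasawaAlgebra p} {n : ℕ}
    (hdvd : ξ ∣ (p : IwasawaAlgebra p) ^ n * L) (hξ0 : ξ ≠ 0) (hμ : mu ξ = 0) : ξ ∣ L := by
  have hpn : (p : IwasawaAlgebra p) ^ n = C ((p : ℤ_[p]) ^ n) := by rw [C_pow_eq, map_natCast]
  rw [hpn] at hdvd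
  exact dvd_of_dvd_C_pow_mul_of_mu_eq_zero hdvd hξ0 hμ

end Algebra

/-! ## §2. Kobayashi's Thm. 4.1 made integral by `μ`, at ANY image -/

section Kato

variable {W : WeierstrassCurve ℚ} [W.IsElliptic] [W.IsGloballyMinimal] {p : ℕ} [Fact p.Prime]
  {N : ℕ} [NeZero N] {f : CuspForm (Gamma0 N) 2}
  {κ : ZpExtension ℚ p} {γ : absoluteGaloisGroup ℚ} {ε : ℤˣ}

/-- **`ξ^ε ∣ L_p^ε` at ANY image of `ρ̄_{E,p}`, as soon as `μ(ξ^ε) = 0`.** Granted Kobayashi's Thm. 4.1 BY NAME (`h41`;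
only the image-free display `∃ n, pⁿ L ∈ Char X^ε` is used): odd good `p`, `a_p = 0`, `f` a newform of `W`, the cyclotomic
pair `(κ, γ)` at the pinned variable, ANY signed `p`-adic `L`-function `L ≠ 0` of sign `ε`, a finitely generated torsion
datum `D` with `char X^ε = (ξ)` and `μ(ξ) = 0`: then `ξ ∣ L` in `Λ` — the integral display WITHOUT the surjectivity
hypothesis. So on crux 4's small-image domain the whole integrality defect of Kato's Euler system is the `μ`-invariant of
the signed Selmer group. [cite: Kobayashi2003, Thm. 4.1 (p. 8)] [cite: Kato2004Asterisque, Thm. 12.5 and §17.13]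
[cite: Washington1997, §13.1] -/
theorem dvd_of_charIdeal_eq_span_of_mu_eq_zero (h41 : thm41_signedCharIdeal_divisibility) (hp : p ≠ 2)
    (hgood : W.HasGoodReductionAtPrime p) (hap : W.frobeniusTrace p = 0) (hf : IsNewformOf W f)
    (hκ : κ.IsCyclotomic) (hγ : κ.IsTopGenerator γ) (hγ' : IsCyclotomicVariable p γ)
    {L : IwasawaAlgebra p} (hL : IsSignedPAdicLFunction f p ε L) (hL0 : L ≠ 0)
    (D : SignedSelmerDualData W κ γ ε) [Module.Finite (IwasawaAlgebra p) D.X]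
    (hX : Module.IsTorsion (IwasawaAlgebra p) D.X)
    {ξ : IwasawaAlgebra p} (hξ : D.charIdeal = Ideal.span {ξ}) (hμ : mu ξ = 0) : ξ ∣ L := by
  obtain ⟨n, hn⟩ := h41.exists_dvd_pow_mul hp hgood hap hf hκ hγ hγ' hL D hX hξ
  have hξ0 : ξ ≠ 0 := by
    rintro rfl
    obtain ⟨c, hc⟩ := hn
    rw [zero_mul] at hc
    have hpn : (p : IwasawaAlgebra p) ^ n = C ((p : ℤ_[p]) ^ n) := by rw [C_pow_eq, map_natCast]
    rw [hpn] at hc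
    exact mul_ne_zero (C_pow_ne_zero n) hL0 hc
  exact dvd_of_dvd_natCast_pow_mul_of_mu_eq_zero hn hξ0 hμ

end Kato

/-! ## §3. The main conjecture from the Eisenstein half and `μ^ε = 0`, at ANY image -/

section MainConjecture

variable (W : WeierstrassCurve ℚ) [W.IsElliptic] [W.IsGloballyMinimal] (p : ℕ) [Fact p.Prime]

/-- **`KobayashiMainConjecture W p ε` ⟸ `KobayashiLowerDivisibility W p ε` ∧ `μ^ε = 0`, at ANY image, ANY rank.** Granted
BY NAME `h12` (Thm. 1.2), `h41` (Thm. 4.1, rational display only), `h5`/`h3` (period units): if the Eisenstein half holds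
for the sign `ε` and, for every `(κ, γ)` of the binder and every key-`γ` dual datum, some characteristic power series has
`μ = 0`, then Kobayashi's main conjecture holds for `ε`. Proof: `char X^ε = (ξ)`; lower: `(ξ) = (u·L·h)`; §2: `ξ ∣ L`;
so `L·(u h) ∣ L`, `h` is a unit, `(ξ) = (u·L)` with `(u·L)^ℚ = ϖ·L^ℚ`. The `mu`-currency twin of
`SmallImageSignedMuDefect.kobayashiMainConjecture_of_lengthAt_le_of_lowerDivisibility`; no ζ-package, no Conjecture A,
no surjectivity. [cite: Kobayashi2003, Thm. 1.2, Thm. 4.1 and Conjecture (p. 2)] [cite: GreenbergVatsal2000, p. 4] -/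
theorem kobayashiMainConjecture_of_lowerDivisibility_of_mu_eq_zero
    (h12 : Kobayashi2003.thm12_signedSelmerDual_finite_torsion)
    (h41 : Kobayashi2003.thm41_signedCharIdeal_divisibility)
    (h5 : realPeriodRat_eq_unit_mul_plusPeriod) (h3 : realPeriodRat_eq_unit_mul_plusPeriod_three)
    (hp : p ≠ 2) (hgood : W.HasGoodReductionAtPrime p) (hap : W.frobeniusTrace p = 0) {ε : ℤˣ}
    (hlow : KobayashiLowerDivisibility W p ε)
    (hμX : ∀ (κ : ZpExtension ℚ p) (γ : absoluteGaloisGroup ℚ), κ.IsCyclotomic → κ.IsTopGenerator γ →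
      IsCyclotomicVariable p γ → ∀ (D : SignedSelmerDualData W κ γ ε) (ξ : IwasawaAlgebra p),
        D.charIdeal = Ideal.span {ξ} → mu ξ = 0) :
    KobayashiMainConjecture W p ε := by
  intro κ γ hκ hγ hγ' _ f hf ϖ hϖ Lplus Lminus hPP D
  haveI : Module.Finite (IwasawaAlgebra p) D.X := h12.moduleFinite hp hgood hap hκ hγ D
  have hX : Module.IsTorsion (IwasawaAlgebra p) D.X := h12.isTorsion hp hgood hap hκ hγ D
  refine ⟨hX, ?_⟩
  -- the Eisenstein half: `char = (g)`, `g^ℚ = ϖ (L h)^ℚ`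
  obtain ⟨g, h, hg, hgι⟩ := hlow κ γ hκ hγ hγ' f hf ϖ hϖ Lplus Lminus hPP D
  set L := kobayashiL ε Lplus Lminus with hL_def
  have hL : IsSignedPAdicLFunction f p ε L := hPP.isSignedPAdicLFunction_kobayashiL ε
  have hL0 : L ≠ 0 := by
    rw [hL_def, kobayashiL]
    split_ifs
    · exact hPP.2.1
    · exact hPP.1
  -- the period ratio is a unit `u` with `u = ϖ`; so `g = C u * (L * h)`
  have hirr : W.HasIrreducibleModPGaloisRep p :=
    hasIrreducibleModPGaloisRep_of_dvd_frobeniusTrace W p hp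
      (W.not_dvd_minimalDiscriminantInt_of_hasGoodReductionAtPrime' p hgood) (by rw [hap]; exact dvd_zero _)
  have hvϖ : padicValRat p ϖ = 0 := padicValRat_periodRatio_eq_zero h5 h3 W p hp hgood hirr f hf ϖ hϖ
  have hϖ0 : ϖ ≠ 0 := by
    intro h0
    rw [h0, Rat.cast_zero, zero_mul] at hϖ
    exact (IsNewform0.plusPeriod_pos_holds hf.1 hf.coeffField_eq_bot).ne' hϖ.symm
  obtain ⟨u, hu⟩ := exists_units_coe_eq_ratCast hϖ0 hvϖ
  obtain ⟨hspanu, hιu⟩ := span_C_units_mul_eq u L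
  obtain ⟨-, hιu'⟩ := span_C_units_mul_eq u (L * h)
  have hgeq : g = C (u : ℤ_[p]) * (L * h) := by
    apply iwasawaToPowerSeries_injective p
    rw [hgι, hιu', hu]
  -- Kato made integral by `μ`: `g ∣ L`
  have hμ : mu g = 0 := hμX κ γ hκ hγ hγ' D g hg
  have hgL : g ∣ L := dvd_of_charIdeal_eq_span_of_mu_eq_zero h41 hp hgood hap hf hκ hγ hγ' hL hL0 D hX hg hμ
  -- so `h · C u` divides `1`: `h` is a unit, `(g) = (C u · L)`
  obtain ⟨c, hc⟩ := hgL
  have hunit : IsUnit h := by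
    refine IsUnit.of_mul_eq_one (C (u : ℤ_[p]) * c) ?_
    apply mul_left_cancel₀ hL0
    calc L * (h * (C (u : ℤ_[p]) * c)) = (C (u : ℤ_[p]) * (L * h)) * c := by ring
      _ = L := by rw [← hgeq, ← hc]
      _ = L * 1 := (mul_one L).symm
  refine ⟨C (u : ℤ_[p]) * L, ?_, ?_⟩
  · rw [hg, hgeq, ← mul_assoc]
    exact Ideal.span_singleton_mul_right_unit hunit _
  · rw [hιu, hu]

end MainConjecture

end Summit.BirchSwinnertonDyer.BirchSwinnertonDyer.Theorems.SmallImageKatoIntegralOfMu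

end
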